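import Summits.PneNP.PneNP.Theorems.SymmetryBudgetWindowHamCruxLinks
import Literature.Computability.Cryptography.OneWayFunctionsPPoly
import HarnessLib

/-!
# `WindowHam` under the non-uniform one-way-function hypothesis

Route `PneNP/SymmetryBudget`, crux `WindowHam` (item stmt-PneNP-2143), which is `NP ⊄ P/poly` under
the kernel-checked equivalence `windowHam_iff_not_np_subset_PPoly`
(`SymmetryBudgetWindowHamIffNPNotSubsetPPoly.lean`). The tree theorem
`Literature.Computability.Cryptography.NP_not_subset_PPoly_of_NonuniformOWFExist`
(`OneWayFunctionsPPoly.lean`: a non-uniformly one-way function — Goldreich 2001, Def. 2.2.6, the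
thesis-level hypothesis of the routes `PneNP/MetaCplx`, `PneNP/Learning`, `PneNP/Ktlang`, … in its
non-uniform form — forces `NP ⊄ P/poly`, by Karp–Lipton's advice-driven self-reduction applied to
Goldreich's set `L_f`) places one more standard conjecture ABOVE the crux in the conjecture web
(`SymmetryBudgetWindowHamConjectureWeb.lean`, `SymmetryBudgetWindowHamOfHardPRG.lean`):

* `windowHam_of_nonuniformOWFExist` — `NonuniformOWFExist → WindowHam` (the item closed modulo the
  registered open conjecture `NonuniformOWFExist`);
* `windowHam_of_nonuniformOWFHypothesis` — the same from the statement-level flag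
  `NonuniformOWFHypothesis` (crypto-foundations.S22);
* `not_nonuniformOWFExist_of_not_windowHam` — contrapositive: refuting the crux (`NP ⊆ P/poly`)
  kills non-uniform one-way functions, i.e. all of non-uniform cryptography;
* `circuitThesis_of_nonuniformOWFExist`, `rigidBenchmark_of_nonuniformOWFExist` — the same edge for
  the sibling cruxes `Circuit.CircuitThesis` (stmt-PneNP-10624) and `RigidBenchmark`
  (stmt-PneNP-2149);
* `pneNP_of_nonuniformOWFExist` — the summit under the hypothesis, through `WindowHam`.

All proofs are one-liners over landed modules; the mathematics is in
`NP_not_subset_PPoly_of_NonuniformOWFExist`.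
-/

namespace Summit.PneNP.PneNP.Theorems

open Literature.Computability.Complexity Literature.Computability.Cryptography
open Summit.PneNP.PneNP.Theses.SymmetryBudget (WindowHam RigidBenchmark)
open Summit.PneNP.PneNP.Theses.Circuit (CircuitThesis)

/-- **The crux under the non-uniform one-way-function hypothesis.** If some polynomial-time `f` is
one-way against PPT adversaries with polynomial advice (`NonuniformOWFExist`, Goldreich 2001,
Def. 2.2.6), then `WindowHam` holds: `NonuniformOWFExist → NP ⊄ P/poly`
(`NP_not_subset_PPoly_of_NonuniformOWFExist`) and `WindowHam ↔ NP ⊄ P/poly`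
(`windowHam_iff_not_np_subset_PPoly`). -/
theorem windowHam_of_nonuniformOWFExist (h : NonuniformOWFExist) : WindowHam :=
  windowHam_iff_not_np_subset_PPoly.2 (NP_not_subset_PPoly_of_NonuniformOWFExist h)

/-- The crux from the statement-level flag `NonuniformOWFHypothesis` (crypto-foundations.S22,
definitionally `NonuniformOWFExist`). -/
theorem windowHam_of_nonuniformOWFHypothesis (h : NonuniformOWFHypothesis) : WindowHam :=
  windowHam_of_nonuniformOWFExist h

/-- **Contrapositive.** A refutation of the crux (`¬ WindowHam`, i.e. `NP ⊆ P/poly`) refutes the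
existence of non-uniformly one-way functions. -/
theorem not_nonuniformOWFExist_of_not_windowHam (h : ¬ WindowHam) : ¬ NonuniformOWFExist :=
  fun hO => h (windowHam_of_nonuniformOWFExist hO)

/-- The sibling crux `CircuitThesis` (route `PneNP/Circuit`, item stmt-PneNP-10624, literally
`¬ (NP ⊆ P/poly)`) under the non-uniform one-way-function hypothesis. -/
theorem circuitThesis_of_nonuniformOWFExist (h : NonuniformOWFExist) : CircuitThesis :=
  circuitThesis_of_windowHam (windowHam_of_nonuniformOWFExist h)

/-- The sibling crux `RigidBenchmark` (this route, item stmt-PneNP-2149) under the non-uniform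
one-way-function hypothesis. -/
theorem rigidBenchmark_of_nonuniformOWFExist (h : NonuniformOWFExist) : RigidBenchmark :=
  rigidBenchmark_of_windowHam (windowHam_of_nonuniformOWFExist h)

/-- **The summit under the hypothesis**, through the crux: `NonuniformOWFExist → P ≠ NP`
(`pneNP_of_windowHam`; the direct route `pneNP_shape_of_NonuniformOWFExist` of
`OneWayFunctionsPneNP.lean` reaches Cook's shape without circuits — this one records that the
hypothesis enters the summit ABOVE the `NP ⊄ P/poly` node). -/
theorem pneNP_of_nonuniformOWFExist (h : NonuniformOWFExist) : _root_.PneNP :=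
  pneNP_of_windowHam (windowHam_of_nonuniformOWFExist h)

end Summit.PneNP.PneNP.Theorems
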